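import Summits.Ventures.CertifiedManyBodySolver.Theorems.TcThermcert1FugacityProjection
import Mathlib
import HarnessLib

/-!
# The free two-fugacity normalisation (K2 groundwork, part 0)

Helper file for route `TcThermcert1`, crux `ThermalStiffnessCeilingU8b10_le_1o8` (item `stmt-Ventures-26381`), line
`Cruxes/ThermalStiffnessCeilingU8b10_le_1o8/Lines/zerofree_corridor.lean` v9, registered stub K2 `stub_gcHighTempAnalytic`
(`Ξ_L(β, ζ↑, ζ↓; θ) = (1+ζ↑)^{L²} (1+ζ↓)^{L²} e^{L² h(ζ)}` with `h` analytic and `ε`-small on the fugacity annulus pair, `‖β‖ ≤ η₀`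
uniformly in `L`).  This file records the `β = 0` end of that statement and the annulus constants every port of the high-temperature
polymer expansion (tree `Literature/MathematicalPhysics/QuantumLattice/HubbardHighTemperatureAnalytic.lean`, Kotecký–Preiss) starts from:

* `sum_pow_card_eq`, `sum_fugacity_weights`: `Σ_s z^{#↑s} w^{#↓s} = (1+z)^{#Λ} (1+w)^{#Λ}` over occupation configurations
  `s : Finset (Orb Λ)` (configurations ≃ pairs (up-set, down-set) via `upPart`/`downPart`/`pairSet`, then the binomial theorem per species);
* `trace_diagonal_fugacity_exp_zero`: `tr(diag(z^{N↑} w^{N↓}) e^{−0·H}) = (1+z)^{#Λ} (1+w)^{#Λ}`;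
* `norm_one_add_ge_of_mem_annulus`, `one_add_ne_zero_of_mem_annulus`, `site_ratio_le_of_mem_annulus`: on `2/3 < |ζ| < 8/9`,
  `|1+ζ| ≥ 1/9`, so the free one-site normalisation `(1+ζ↑)(1+ζ↓)` has modulus `≥ 1/81` and the site ratio
  `(1+|ζ↑|)(1+|ζ↓|)/|(1+ζ↑)(1+ζ↓)|` is `≤ 289` on the whole annulus pair (no arc surgery needed);
* `gcTwist_trace_beta_zero`: K2's identity at `β = 0` with `h = 0` for the `t–t′` seam-flux torus (`#Λ = L²`).

[folklore] Finite combinatorics and the triangle inequality; no physics claim — nothing about superconductivity in the Hubbard model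
is proved by anything in this file.  No definitions; no `sorry`.
-/

noncomputable section

namespace Summit.Ventures.CertifiedManyBodySolver.Theorems.TcThermcert1.ZeroFreeCorridor

open Matrix Finset Complex
open Literature.MathematicalPhysics.QuantumLattice

/-! ## §1 The free two-fugacity sum over occupation configurations -/

section Config

variable {Λ : Type*} [LinearOrder Λ] [Fintype Λ]

omit [LinearOrder Λ] in
/-- The one-species free sum: `Σ_{A ⊆ Λ} z^{#A} = (1 + z)^{#Λ}`. -/
theorem sum_pow_card_eq (z : ℂ) : ∑ A : Finset Λ, z ^ A.card = (1 + z) ^ Fintype.card Λ := by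
  have := Fintype.sum_pow_mul_eq_add_pow Λ z 1
  simp only [one_pow, mul_one] at this
  rw [this, add_comm]

/-- **The free two-fugacity grand-canonical sum** `Σ_s z^{#↑s} w^{#↓s} = (1+z)^{#Λ} (1+w)^{#Λ}` (the `β = 0` normalisation of the
two-fugacity trace). -/
theorem sum_fugacity_weights (z w : ℂ) :
    ∑ s : Finset (Orb Λ), z ^ (upPart s).card * w ^ (downPart s).card = (1 + z) ^ Fintype.card Λ * (1 + w) ^ Fintype.card Λ := by
  -- occupation configurations are pairs (up-set, down-set): `s ↦ (upPart s, downPart s)` with inverse `pairSet`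
  let e : Finset (Orb Λ) ≃ Finset Λ × Finset Λ :=
    ⟨fun s => (upPart s, downPart s), fun p => pairSet p.1 p.2, fun s => pairSet_upPart_downPart s, fun p => by simp⟩
  have h := Fintype.sum_equiv e (fun s => z ^ (upPart s).card * w ^ (downPart s).card)
    (fun p : Finset Λ × Finset Λ => z ^ p.1.card * w ^ p.2.card) fun s => rfl
  rw [h, Fintype.sum_prod_type, ← sum_pow_card_eq z, ← sum_pow_card_eq w, Finset.sum_mul_sum]

/-- The two-fugacity trace of the identity (`β = 0`): `tr diag(z^{N↑} w^{N↓}) = (1+z)^{#Λ}(1+w)^{#Λ}`, stated with `e^{−0·H}`. -/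
theorem trace_diagonal_fugacity_exp_zero {inst : DecidableEq (Finset (Orb Λ))} (H : Matrix (Finset (Orb Λ)) (Finset (Orb Λ)) ℂ)
    (z w : ℂ) :
    (@diagonal _ ℂ inst _ (fun s : Finset (Orb Λ) => z ^ (upPart s).card * w ^ (downPart s).card) *
        NormedSpace.exp (-(0 : ℂ) • H)).trace = (1 + z) ^ Fintype.card Λ * (1 + w) ^ Fintype.card Λ := by
  rw [neg_zero, zero_smul, NormedSpace.exp_zero, trace_diagonal_fugacity_mul]
  simp only [Matrix.one_apply_eq, one_mul]
  exact sum_fugacity_weights z w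

end Config

/-! ## §2 The fugacity annulus: one-site normalisation and site ratio -/

/-- On the annulus `2/3 < |ζ| < 8/9`: `|1 + ζ| ≥ 1/9`. -/
theorem norm_one_add_ge_of_mem_annulus {ζ : ℂ} (hζ : ζ ∈ {ζ : ℂ | 2 / 3 < ‖ζ‖ ∧ ‖ζ‖ < 8 / 9}) : 1 / 9 ≤ ‖1 + ζ‖ := by
  obtain ⟨-, h2⟩ := hζ
  have := norm_sub_norm_le (1 : ℂ) (-ζ)
  rw [norm_neg, norm_one, sub_neg_eq_add] at this
  linarith

/-- On the annulus `1 + ζ ≠ 0`. -/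
theorem one_add_ne_zero_of_mem_annulus {ζ : ℂ} (hζ : ζ ∈ {ζ : ℂ | 2 / 3 < ‖ζ‖ ∧ ‖ζ‖ < 8 / 9}) : 1 + ζ ≠ 0 := by
  intro h
  have := norm_one_add_ge_of_mem_annulus hζ
  rw [h, norm_zero] at this
  linarith

/-- On the annulus pair the free one-site normalisation `(1+ζ↑)(1+ζ↓)` has modulus `≥ 1/81` and the site ratio
`(1+|ζ↑|)(1+|ζ↓|)/|(1+ζ↑)(1+ζ↓)| ≤ 289`. -/
theorem site_ratio_le_of_mem_annulus {ζ : ℂ × ℂ}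
    (hζ : ζ ∈ ({ζ : ℂ | 2 / 3 < ‖ζ‖ ∧ ‖ζ‖ < 8 / 9} ×ˢ {ζ : ℂ | 2 / 3 < ‖ζ‖ ∧ ‖ζ‖ < 8 / 9})) :
    1 / 81 ≤ ‖(1 + ζ.1) * (1 + ζ.2)‖ ∧ (1 + ‖ζ.1‖) * (1 + ‖ζ.2‖) / ‖(1 + ζ.1) * (1 + ζ.2)‖ ≤ 289 := by
  obtain ⟨h1, h2⟩ := Set.mem_prod.mp hζ
  have ha := norm_one_add_ge_of_mem_annulus h1
  have hb := norm_one_add_ge_of_mem_annulus h2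
  have hprod : 1 / 81 ≤ ‖(1 + ζ.1) * (1 + ζ.2)‖ := by
    rw [norm_mul]; nlinarith
  refine ⟨hprod, ?_⟩
  rw [div_le_iff₀ (by linarith)]
  have hu : (1 + ‖ζ.1‖) * (1 + ‖ζ.2‖) ≤ (17 / 9) * (17 / 9) := by
    have := h1.2; have := h2.2
    exact mul_le_mul (by linarith) (by linarith) (by positivity) (by norm_num)
  linarith

/-! ## §3 The `t–t′` flux torus at `β = 0` -/

section Torus

variable (L : ℕ) [NeZero L]

/-- **K2 at `β = 0` with `h = 0`.**  The two-fugacity twisted grand-canonical trace of the `t–t′` seam-flux Hubbard torus at `β = 0`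
is the free normalisation: `tr(diag(ζ↑^{N↑} ζ↓^{N↓}) e^{−0·H}) = (1+ζ↑)^{L²} (1+ζ↓)^{L²} · e^{L²·0}`. -/
theorem gcTwist_trace_beta_zero (tp U θ : ℝ) (ζu ζd : ℂ) :
    (diagonal (fun s : Finset (Orb (FermionTorus 2 L)) => ζu ^ (upPart s).card * ζd ^ (downPart s).card) *
        NormedSpace.exp (-(0 : ℂ) • hubbardTorusTT'Flux L tp U θ)).trace =
      (1 + ζu) ^ (L ^ 2) * (1 + ζd) ^ (L ^ 2) * cexp ((L : ℂ) ^ 2 * 0) := by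
  rw [trace_diagonal_fugacity_exp_zero, mul_zero, Complex.exp_zero, mul_one,
    show Fintype.card (FermionTorus 2 L) = L ^ 2 by simp]

end Torus

end Summit.Ventures.CertifiedManyBodySolver.Theorems.TcThermcert1.ZeroFreeCorridor

end
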